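/-
Copyright (c) 2026 the pub-hodgecm-mathlib formalisation cell (harness21).  Prover seat hodgecm-mathlib-LH4-p03 (g8); dealer LH4-plan (g6) WORD #102 (P3⁗-2)
«LAYER B 2∕3», 2026-09-02.  Count-neutral base layer of the dyadic (D-UNR) column (FINDING #6 of the LH4 board).
-/
import Literature.NumberTheory.Automorphic.UnitaryThreeDoubleCosetsHKTrace
import Literature.NumberTheory.Automorphic.UnitaryThreeDoubleCosetsHKStabilizer
import HarnessLib

/-!
# Flicker's double cosets WITHOUT `|2| = 1` — file 2: the stabiliser `H^K_m = H ∩ u_m^{(y,z)} K u_m^{(y,z)⁻¹}` by congruences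
# (Flicker 1998, «Elementary proof of the fundamental lemma for a unitary group», Prop. 4 p. 81 — every residue characteristic)

Topic `NumberTheory/Automorphic`; namespace `Literature.NumberTheory.Automorphic.UnitaryGroup`.  THEOREMS ONLY (no `def`, no instance, no notation, no named
fact, no `sorry`).  Cell `pub/hodgecm-mathlib`, crux H413 = `stmt-HodgeConjecture-24833`; LH4 board (D-UNR) FINDING #6, «LAYER B 2∕3»: the twin of ★
`UnitaryThreeDoubleCosetsHKStabilizer` (file 2 of Flicker's engine) over ★ `UnramifiedLocalConjDatum` and the 2-free level elements of ★
`UnitaryThreeDoubleCosetsHKTrace` (file 1′),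

  `u_m^{(y,z)} = !![ϖ^m, y, z·ϖ^{−m}; 0, 1, −σy·ϖ^{−m}; 0, 0, ϖ^{−m}]`,  `z + σz + y·σy = 0`,  `|y| = 1` (no bound on `|z|` is needed here).

For a block element `h = !![α,0,β; 0,e,0; γ,0,δ] ∈ H = Z_U(diag(1,−1,1))` write `t = ϖ^m`, `A := α − e + γ·σz`, `D := γ·z + δ − e`.
* §1 **`coe_flickerU_of_rel_inv_mul_mul`** — the explicit conjugate
  `u⁻¹ h u = !![α + γσz, y·A∕t, (β + z·(α−e) + σz·D)∕t²; t·σy·γ, e + γ·yσy, σy·D∕t; t²γ, t·y·γ, γz + δ]`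
  (computed with the INTEGRAL inverse `u⁻¹ = d_m⁻¹·u(−y, σz)` of ★ file 1′; the `(0,2)` numerator `αz + β + e·yσy + γ·zσz + δ·σz` is rewritten by the relation as
  `β + z·(α−e) + σz·D`).  Flicker's matrix (★ `coe_flickerU_inv_mul_mul_flickerU`) is the instance `z = σz = 1`, `yσy = −2`: `α+γ`, `e − 2γ`, `α+β+γ+δ−2e`.
* §2 **`flickerU_of_rel_inv_mul_mul_mem_unitaryInt_iff`** — `H^K_m` BY CONGRUENCES at every residue characteristic:
  `u⁻¹ h u ∈ K₀ ↔ |γ| ≤ 1 ∧ |A| ≤ |t| ∧ |D| ≤ |t| ∧ |β + z·(α−e) + σz·D| ≤ |t|²`.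
  The one `|2| = 1` step of ★ :139–:144 (`|2γ| ≤ max(|e|, |e − 2γ|) ⟹ |γ| ≤ 1`) becomes `|γ·yσy| ≤ max(|e|, |e + γ·yσy|)` with `|yσy| = 1`: the `(1,1)` entry
  of the conjugate is `e + γ·N(y)`, a UNIT multiple of `γ` plus the unit `e` — which is exactly why the `(y,z)`-frame needs no `|2|`.
* §3 `flickerU_trace_inv_mul_mul_mem_unitaryInt_iff` — the trace-frame instance `(y,z) = (1, −b)`, `b + σb = 1`: `A = α − e − γσb`, `D = δ − e − γb`, `(1,1) = e + γ`.
Reused BY NAME (2-free already): ★ `exists_coe_eq_block_of_mem_centralizer (h2 : (2:K) ≠ 0)` (block shape — characteristic condition), ★ `v_eq_one_of_coe_eq_block`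
(`|e| = 1`), ★ (ED. 2) `exists_mul_mul_eq_mul_mul_iff_mem_unitaryInt` ∕ `inv_mul_mem_unitaryInt_iff` (pure bookkeeping).  Consumer: LAYER B 3∕3 (the coset counts of
Props. 8–10, 12–13 in these coordinates).  HONEST LABEL: HC_CM is proved only modulo the printed citations (hLiu418 = `stmt-HodgeConjecture-24832`, h413 =
`stmt-HodgeConjecture-24833`) until rung 0 closes; structure theory, pays no organ, opens no road ((D-UNR) stays PRINT by D74′).

## References
* [Flicker1998UnitaryFL] Y. Z. Flicker, *Elementary proof of the fundamental lemma for a unitary group*, Canad. J. Math. 50 (1998), §2 p. 78, Prop. 4 p. 81 (`H^K_m`).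
* [Rogawski1990] J. D. Rogawski, *Automorphic Representations of Unitary Groups in Three Variables* (1990), §1.9–§1.10 pp. 8–9.
-/

set_option autoImplicit false

open scoped MatrixGroups WithZero
open Matrix

namespace Literature.NumberTheory.Automorphic

namespace UnitaryGroup

open Literature.NumberTheory.Automorphic.HermitianLattice (unitaryInt mem_unitaryInt_iff UnramifiedLocalConjDatum)

section StabilizerTrace

variable {K : Type*} [Field K] [Valued K ℤᵐ⁰] {ϖ : K}
  (σ : K →+* K) {J : Matrix (Fin 3) (Fin 3) K} (hJ : J = (StdForm.antidiagonal 3).over K)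

/-! ## §1 The conjugate `u⁻¹ h u` explicitly -/

/-- **The conjugate `u⁻¹ h u` of a block element `h = !![α,0,β;0,e,0;γ,0,δ] ∈ H` by `u = u_m^{(y,z)}`, explicitly** (`t = ϖ^m`, `z + σz + yσy = 0`,
`A = α − e + γσz`, `D = γz + δ − e`):
`u⁻¹ h u = !![α + γσz, y·A∕t, (β + z·(α−e) + σz·D)∕t²; t·σy·γ, e + γ·yσy, σy·D∕t; t²γ, t·y·γ, γz + δ]`.  Twin of ★ `coe_flickerU_inv_mul_mul_flickerU` (Flicker's
`z = 1`, `yσy = −2`). [cite: Flicker1998UnitaryFL, Prop. 4 p. 81] -/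
theorem coe_flickerU_of_rel_inv_mul_mul (hd : UnramifiedLocalConjDatum σ ϖ) {y z : K} (hz : z + σ z + y * σ y = 0) (m : ℕ)
    {u h : ↥(unitaryGroupOfForm σ J)}
    (hu : ((u : GL (Fin 3) K) : Matrix (Fin 3) (Fin 3) K) = !![ϖ ^ m, y, z * (ϖ ^ m)⁻¹; 0, 1, -σ y * (ϖ ^ m)⁻¹; 0, 0, (ϖ ^ m)⁻¹])
    {α β γ δ e : K} (hh : ((h : GL (Fin 3) K) : Matrix (Fin 3) (Fin 3) K) = !![α, 0, β; 0, e, 0; γ, 0, δ]) :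
    (((u⁻¹ * h * u : ↥(unitaryGroupOfForm σ J)) : GL (Fin 3) K) : Matrix (Fin 3) (Fin 3) K) =
      !![α + γ * σ z, y * (α - e + γ * σ z) * (ϖ ^ m)⁻¹, (β + z * (α - e) + σ z * (γ * z + δ - e)) * (ϖ ^ m)⁻¹ * (ϖ ^ m)⁻¹;
         ϖ ^ m * σ y * γ, e + γ * (y * σ y), σ y * (γ * z + δ - e) * (ϖ ^ m)⁻¹;
         ϖ ^ m * ϖ ^ m * γ, ϖ ^ m * y * γ, γ * z + δ] := by
  have ht0 : ϖ ^ m ≠ 0 := pow_ne_zero _ hd.ϖ_ne_zero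
  rw [Subgroup.coe_mul, Subgroup.coe_mul, Units.val_mul, Units.val_mul, coe_inv_of_coe_eq_flickerU_of_rel σ hd hz hu, hh, hu]
  simp only [Matrix.mul_fin_three]
  ext i j
  fin_cases i <;> fin_cases j <;> simp only [Matrix.of_apply, Matrix.cons_val', Matrix.cons_val_zero, Matrix.cons_val_one,
    Matrix.cons_val_fin_one, Matrix.cons_val, Matrix.empty_val', Fin.mk_one, Fin.zero_eta, Fin.reduceFinMk, mul_zero, zero_mul,
    add_zero, zero_add, mul_one, one_mul]
  all_goals first
    | (field_simp; linear_combination (e) * hz)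
    | (field_simp; linear_combination (-e) * hz)
    | (field_simp; ring)
    | field_simp

/-! ## §2 `H^K_m` by congruences -/

include hJ in
/-- **`H^K_m = H ∩ u K₀ u⁻¹` BY CONGRUENCES, `u = u_m^{(y,z)}`, at every residue characteristic** [Flicker1998UnitaryFL Prop. 4, p. 81]: for a block element
`h = !![α,0,β;0,e,0;γ,0,δ] ∈ U`, `t = ϖ^m`, `|y| = 1`, `z + σz + yσy = 0` (no bound on `|z|` is needed), with `A := α − e + γσz`, `D := γz + δ − e`:
`u⁻¹ h u ∈ K₀ ↔ |γ| ≤ 1 ∧ |A| ≤ |t| ∧ |D| ≤ |t| ∧ |β + z·(α−e) + σz·D| ≤ |t|²`.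
The `(1,1)` entry of the conjugate is `e + γ·yσy` with `|yσy| = 1`, so `|γ| ≤ 1` follows from integrality WITHOUT `|2| = 1` (★'s `e − 2γ` needed it).  Twin of ★
`flickerU_inv_mul_mul_flickerU_mem_unitaryInt_iff`. [cite: Flicker1998UnitaryFL, Prop. 4 p. 81] -/
theorem flickerU_of_rel_inv_mul_mul_mem_unitaryInt_iff (hd : UnramifiedLocalConjDatum σ ϖ) {y z : K} (hy : Valued.v y = 1)
    (hz : z + σ z + y * σ y = 0) (m : ℕ)
    {u h : ↥(unitaryGroupOfForm σ J)}
    (hu : ((u : GL (Fin 3) K) : Matrix (Fin 3) (Fin 3) K) = !![ϖ ^ m, y, z * (ϖ ^ m)⁻¹; 0, 1, -σ y * (ϖ ^ m)⁻¹; 0, 0, (ϖ ^ m)⁻¹])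
    {α β γ δ e : K} (hh : ((h : GL (Fin 3) K) : Matrix (Fin 3) (Fin 3) K) = !![α, 0, β; 0, e, 0; γ, 0, δ]) :
    u⁻¹ * h * u ∈ unitaryInt σ J ↔
      Valued.v γ ≤ 1 ∧ Valued.v (α - e + γ * σ z) ≤ Valued.v (ϖ ^ m) ∧ Valued.v (γ * z + δ - e) ≤ Valued.v (ϖ ^ m) ∧
        Valued.v (β + z * (α - e) + σ z * (γ * z + δ - e)) ≤ Valued.v (ϖ ^ m) * Valued.v (ϖ ^ m) := by
  have hvσy : Valued.v (σ y) = 1 := by rw [hd.vσ, hy]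
  have hvN : Valued.v (y * σ y) = 1 := by rw [map_mul, hy, hvσy, one_mul]
  have ht0 : Valued.v (ϖ ^ m) ≠ 0 := (Valuation.ne_zero_iff _).2 (pow_ne_zero _ hd.ϖ_ne_zero)
  have htpos : 0 < Valued.v (ϖ ^ m) := zero_lt_iff.2 ht0
  have ht1 : Valued.v (ϖ ^ m) ≤ 1 := hd.v_pow_le_one m
  have hve : Valued.v e = 1 := v_eq_one_of_coe_eq_block σ hJ hd.vσ hh
  rw [mem_unitaryInt_iff_forall_v_apply_le_one σ hJ hd.vσ, coe_flickerU_of_rel_inv_mul_mul σ hd hz m hu hh]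
  constructor
  · intro H
    have e01 := H 0 1; have e02 := H 0 2; have e11 := H 1 1; have e12 := H 1 2
    simp only [Matrix.of_apply, Matrix.cons_val', Matrix.cons_val_zero, Matrix.cons_val_one, Matrix.cons_val_fin_one, Matrix.cons_val,
      Matrix.empty_val', map_mul, map_inv₀, hy, hvσy, one_mul] at e01 e02 e11 e12
    refine ⟨?_, ?_, ?_, ?_⟩
    · -- `|γ·yσy| ≤ max(|e|, |e + γ·yσy|) ≤ 1`, `|yσy| = 1`
      have h1 : Valued.v (γ * (y * σ y)) ≤ 1 := by
        have : γ * (y * σ y) = (e + γ * (y * σ y)) - e := by ring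
        rw [this]
        exact Valuation.map_sub_le _ e11 hve.le
      rwa [map_mul, hvN, mul_one] at h1
    · rwa [mul_inv_le_iff₀ htpos, one_mul] at e01
    · rwa [mul_inv_le_iff₀ htpos, one_mul] at e12
    · rw [mul_inv_le_iff₀ htpos, one_mul, mul_inv_le_iff₀ htpos] at e02
      exact e02
  · rintro ⟨hγ, h1, h3, h4⟩
    have hαγ : Valued.v (α + γ * σ z) ≤ 1 := by
      have : α + γ * σ z = (α - e + γ * σ z) + e := by ring
      rw [this]; exact Valuation.map_add_le _ (h1.trans ht1) hve.le
    have hγδ : Valued.v (γ * z + δ) ≤ 1 := by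
      have : γ * z + δ = (γ * z + δ - e) + e := by ring
      rw [this]; exact Valuation.map_add_le _ (h3.trans ht1) hve.le
    have heγ : Valued.v (e + γ * (y * σ y)) ≤ 1 :=
      Valuation.map_add_le _ hve.le (by rw [map_mul, hvN, mul_one]; exact hγ)
    intro i j
    fin_cases i <;> fin_cases j <;>
      simp only [Matrix.of_apply, Matrix.cons_val', Matrix.cons_val_zero, Matrix.cons_val_one, Matrix.cons_val_fin_one, Matrix.cons_val,
        Matrix.empty_val', Fin.mk_one, Fin.zero_eta, Fin.reduceFinMk, map_mul, map_inv₀, hy, hvσy, one_mul]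
    · exact hαγ
    · rw [mul_inv_le_iff₀ htpos, one_mul]; exact h1
    · rw [mul_inv_le_iff₀ htpos, one_mul, mul_inv_le_iff₀ htpos]; exact h4
    · exact mul_le_one' (mul_le_one' ht1 le_rfl) hγ |>.trans_eq' (by ring)
    · exact heγ
    · rw [mul_inv_le_iff₀ htpos, one_mul]; exact h3
    · exact mul_le_one' (mul_le_one' ht1 ht1) hγ
    · exact mul_le_one' (mul_le_one' ht1 le_rfl) hγ |>.trans_eq' (by ring)
    · exact hγδ

/-! ## §3 The trace-frame instance `(y, z) = (1, −b)` -/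

include hJ in
/-- **`H^K_m` by congruences in the TRACE FRAME** `u = u_m^{(1,−b)} = !![ϖ^m, 1, −b·ϖ^{−m}; 0, 1, −ϖ^{−m}; 0, 0, ϖ^{−m}]`, `b + σb = 1`: for
`h = !![α,0,β;0,e,0;γ,0,δ] ∈ U`, `t = ϖ^m`, `A = α − e − γσb`, `D = δ − e − γb`:
`u⁻¹ h u ∈ K₀ ↔ |γ| ≤ 1 ∧ |A| ≤ |t| ∧ |D| ≤ |t| ∧ |β − b·A − σb·D| ≤ |t|²` — Flicker's Prop. 4 congruences at every residue characteristic.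
[cite: Flicker1998UnitaryFL, Prop. 4 p. 81] -/
theorem flickerU_trace_inv_mul_mul_mem_unitaryInt_iff (hd : UnramifiedLocalConjDatum σ ϖ) {b : K} (hb : b + σ b = 1) (m : ℕ)
    {u h : ↥(unitaryGroupOfForm σ J)}
    (hu : ((u : GL (Fin 3) K) : Matrix (Fin 3) (Fin 3) K) = !![ϖ ^ m, 1, -b * (ϖ ^ m)⁻¹; 0, 1, -(ϖ ^ m)⁻¹; 0, 0, (ϖ ^ m)⁻¹])
    {α β γ δ e : K} (hh : ((h : GL (Fin 3) K) : Matrix (Fin 3) (Fin 3) K) = !![α, 0, β; 0, e, 0; γ, 0, δ]) :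
    u⁻¹ * h * u ∈ unitaryInt σ J ↔
      Valued.v γ ≤ 1 ∧ Valued.v (α - e - γ * σ b) ≤ Valued.v (ϖ ^ m) ∧ Valued.v (δ - e - γ * b) ≤ Valued.v (ϖ ^ m) ∧
        Valued.v (β - b * (α - e) - σ b * (δ - e - γ * b)) ≤ Valued.v (ϖ ^ m) * Valued.v (ϖ ^ m) := by
  have hz : (-b) + σ (-b) + 1 * σ 1 = 0 := by rw [map_neg, map_one]; linear_combination -hb
  have hu' : ((u : GL (Fin 3) K) : Matrix (Fin 3) (Fin 3) K) =
      !![ϖ ^ m, 1, (-b) * (ϖ ^ m)⁻¹; 0, 1, -σ 1 * (ϖ ^ m)⁻¹; 0, 0, (ϖ ^ m)⁻¹] := by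
    rw [hu, map_one]; ext i j; fin_cases i <;> fin_cases j <;> simp
  have key := flickerU_of_rel_inv_mul_mul_mem_unitaryInt_iff σ hJ hd (y := 1) (z := -b) (by rw [map_one]) hz m hu' hh
  rw [key, map_neg]
  have e1 : α - e + γ * -σ b = α - e - γ * σ b := by ring
  have e2 : γ * -b + δ - e = δ - e - γ * b := by ring
  have e3 : β + -b * (α - e) + -σ b * (δ - e - γ * b) = β - b * (α - e) - σ b * (δ - e - γ * b) := by ring
  rw [e1, e2, e3]

end StabilizerTrace

end UnitaryGroup

end Literature.NumberTheory.Automorphic
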